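import Mathlib.RingTheory.Valuation.Basic
import Mathlib.Algebra.Ring.GeomSum
import Mathlib.Tactic.LinearCombination
import Mathlib.Tactic.FieldSimp
import HarnessLib

/-!
# [GenEll] Thm 2.1 for `ℙ¹ ∖ {0,1,∞}` via the curve `D_e : r^e = x(1−x)` — ramification-locus
# control at good primes (the converse half of the sharp conductor bound)

S. Mochizuki, *Arithmetic elliptic curves in general position*, Math. J. Okayama Univ. 52 (2010),
Thm. 2.1 (ii) ⟹ (i), proof pp. 12–14 [cite: MochizukiGenEll2010, Thm 2.1 proof p.13]: the proof
uses the SHARP form of Prop. 1.6 for the REDUCED divisor `E = φ⁻¹({0,1,∞})_red` on the auxiliary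
curve — a prime at which a point `P` meets `E` is counted once, although the pulled-back function
vanishes there to the order of ramification. In the cell's number-field-only architecture for the
route item `Summit.ABC.ABC.Theses.IUTThetaPilot.GenEllTwo` (abc-iut-S6, `GENELLTWO-P1ROUTE.md`
§3 (d), package W5) the curve is `D_e : r^e = x(1−x)` (`e = 2k+1`), `s := 1 − 2x` (so
`s² = 1 − 4r^e`), `t := 1/r + r^{k+1}/s = (s + r^{k+2})/(rs)`, and the RAMIFICATION FUNCTION
`N := (r²s³)·dt/dr = −s³ + (k+1)r^{k+2} − 2r^{3k+3}` cuts out the ramification divisor `R_t`. The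
bookkeeping of §3 (d) subtracts the credit `ord_w N(P)` at every prime `w` where `t(P)` meets
`B ⊇ t(R_t)` and then sums `ord⁺_w N(P)·log Nw` over ALL primes against the height of `N(P)` —
valid only if EVERY good prime with `ord_w N(P) > 0` is one where `t(P)` meets `A := t(R_t)`. This
file proves that control, convention-free (any field `K` with a valuation `v`; instantiate at
`w.valuation F` and transfer along extensions by Mathlib's `HeightOneSpectrum.valuation_liesOver`):

* (private) HENSEL-LITE ROOT PROXIMITY: `v(c·∏_{a∈R}(ρ − a)) < v(c)` forces `v(ρ − a) < 1`
  for some `a ∈ R` (no integrality needed), and small ultrametric helpers;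
* `psi_identity` — `Ψ(r) = −N(r,s)·N(r,−s)` for
  `Ψ(X) := (1 − 4X^e)³ − ((k+1)X^{k+2} − 2X^{3k+3})²` (leading coefficient `−4`, degree `3e+3`);
* `valuation_N_eq_one_of_r_lt`, `valuation_N_eq_one_of_s_lt`, `one_lt_valuation_N_of_r_gt` — OFF
  THE CHART `N` gives no credit (`v r < 1`, `v s < 1` at primes `∤ 2e`, `v r > 1`);
* `exists_root_near_of_valuation_N_lt` — THE LOCUS LEMMA: in the chart, at a prime with `v 2 = 1`,
  with `Ψ` split (roots `R`) and square roots `σ_a² = 1 − 4a^e` in `K`, `v N(r,s) < 1` forces a pair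
  `(a, σ)`, `a ∈ R`, `σ² = 1 − 4a^e`, with `v(r − a) < 1`, `v(s − σ) < 1`, `v N(a,σ) < 1`; the
  consumer's good-prime hypothesis "`N(a,σ) ≠ 0 ⇒ v N(a,σ) = 1`" (finitely many fixed algebraic
  numbers) turns the last clause into `N(a,σ) = 0`, i.e. `(a,σ) ∈ R_t`;
* `valuation_t_sub_t_lt_one` — then `v(t(r,s) − t(a,σ)) < 1`: `t(P)` MEETS `t(a,σ) ∈ A`;
* `exists_valuation_t_sub_lt_one_of_valuation_N_lt` — THE COMPOSED FORM requested by the W5 holder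
  (abc-iut-w5-d045): at a good prime (`v 2 = v e = 1`, nonzero `N`-values at the points over the
  roots of `Ψ` are units) with the critical values in `B`, `v N(r,s) < 1 ⇒ ∃ b ∈ B, v(t(r,s) − b) < 1`
  for every `v`-integral point `(r,s)` of `D_e`.

Everything is a `theorem` with body; no definitions, no named facts; Mathlib only. This is classical
valuation algebra serving a refereed classical theorem; nothing here refers to the disputed parts of
the abc-iut corpus ([IUTchIII] Cor. 3.12), and no side is taken on it. Deliberately NOT here: the
plane-model identities and the forward half of the local inequality (`v(t−b) < 1 ⇒ v(t−b) < v N`,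
abc-iut-w5-d045 (A)–(C)), heights, conductors, the global summation, the archimedean bound (W5b).
-/

namespace Literature.NumberTheory.DiophantineGeometry.GenEll.RamLocus

open Finset

variable {K : Type*} [Field K] {Γ₀ : Type*} [LinearOrderedCommGroupWithZero Γ₀] (v : Valuation K Γ₀)

section Generic

/-- A valuation is `≤ 1` on the image of `ℕ` (ultrametric inequality, `v 1 = 1`). [folklore] -/
private theorem valuation_natCast_le_one (n : ℕ) : v (n : K) ≤ 1 := by
  induction n with
  | zero => simp
  | succ n ih =>
    rw [Nat.cast_succ]
    exact v.map_add_le ih (le_of_eq v.map_one)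

/-- `v(x^n − y^n) ≤ v(x − y)` for `v`-integral `x, y` (`x − y` divides `x^n − y^n` with an integral
cofactor). [folklore] -/
private theorem valuation_pow_sub_pow_le {x y : K} (hx : v x ≤ 1) (hy : v y ≤ 1) (n : ℕ) :
    v (x ^ n - y ^ n) ≤ v (x - y) := by
  rw [← geom_sum₂_mul, map_mul]
  refine mul_le_of_le_one_left' (v.map_sum_le fun i _ => ?_)
  rw [map_mul, map_pow, map_pow]
  exact mul_le_one' (pow_le_one₀ zero_le hx) (pow_le_one₀ zero_le hy)

/-- HENSEL-LITE ROOT PROXIMITY, product form: if every factor satisfies `1 ≤ v(ρ − a)` then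
`v(c) ≤ v(c · ∏_{a ∈ R} (ρ − a))`. [folklore] -/
private theorem valuation_prod_sub_ge (c ρ : K) (R : Multiset K) (h : ∀ a ∈ R, 1 ≤ v (ρ - a)) :
    v c ≤ v (c * (R.map fun a => ρ - a).prod) := by
  induction R using Multiset.induction_on with
  | empty => simp
  | cons a R ih =>
    rw [Multiset.map_cons, Multiset.prod_cons, mul_left_comm, map_mul]
    have ih' := ih fun b hb => h b (Multiset.mem_cons_of_mem hb)
    calc v c ≤ v (c * (R.map fun a => ρ - a).prod) := ih'
      _ ≤ v (ρ - a) * v (c * (R.map fun a => ρ - a).prod) :=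
          le_mul_of_one_le_left' (h a (Multiset.mem_cons_self a R))

/-- HENSEL-LITE ROOT PROXIMITY: if `v(c · ∏_{a ∈ R} (ρ − a)) < v(c)` then `ρ` is `v`-adically close
to one of the `a`: `v(ρ − a) < 1` for some `a ∈ R`. (For a split polynomial `f = c·∏(X − a)` with
`v`-unit leading coefficient this reads: `v(f(ρ)) < 1 ⇒ ρ` reduces to a root.) [folklore] -/
private theorem exists_valuation_sub_lt_one (c ρ : K) (R : Multiset K)
    (h : v (c * (R.map fun a => ρ - a).prod) < v c) : ∃ a ∈ R, v (ρ - a) < 1 := by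
  by_contra hne
  push Not at hne
  exact absurd (valuation_prod_sub_ge v c ρ R hne) (not_le.mpr h)

/-- If a product of two elements has valuation `< 1`, one of the factors has valuation `< 1`.
[folklore] -/
private theorem valuation_lt_one_or_of_mul_lt_one {x y : K} (h : v (x * y) < 1) : v x < 1 ∨ v y < 1 := by
  by_contra hne
  push Not at hne
  rw [map_mul] at h
  exact absurd (one_le_mul hne.1 hne.2) (not_le.mpr h)

omit [Field K] in
/-- In the (linearly ordered) value group, `γ^n = 1` with `n ≠ 0` forces `γ = 1`. [folklore] -/
private theorem eq_one_of_pow_eq_one_valueGroup {γ : Γ₀} {n : ℕ} (hn : n ≠ 0) (h : γ ^ n = 1) : γ = 1 := by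
  rcases lt_trichotomy γ 1 with hlt | heq | hgt
  · exact absurd h (ne_of_lt (pow_lt_one₀ zero_le hlt hn))
  · exact heq
  · exact absurd h (ne_of_gt (one_lt_pow₀ hgt hn))

end Generic

section Identities

variable {k : ℕ} {r s : K}

/-- `Ψ(r) = −N(r,s)·N(r,−s)` on `D_e`, where `Ψ(X) = (1 − 4X^e)³ − ((k+1)X^{k+2} − 2X^{3k+3})²` and
`N(r,s) = −s³ + (k+1)r^{k+2} − 2r^{3k+3}` is the ramification function `(r²s³)·dt/dr` of
`t = 1/r + r^{k+1}/s` (so the `r`-coordinates of the ramification divisor `R_t` and of its twin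
`ιR_t`, `ι : s ↦ −s`, are roots of `Ψ`). [cite: MochizukiGenEll2010, Thm 2.1 proof p.13] -/
theorem psi_identity (hs : s ^ 2 = 1 - 4 * r ^ (2 * k + 1)) :
    (1 - 4 * r ^ (2 * k + 1)) ^ 3 - (((k : K) + 1) * r ^ (k + 2) - 2 * r ^ (3 * k + 3)) ^ 2 =
      -((-s ^ 3 + ((k : K) + 1) * r ^ (k + 2) - 2 * r ^ (3 * k + 3)) *
        (-(-s) ^ 3 + ((k : K) + 1) * r ^ (k + 2) - 2 * r ^ (3 * k + 3))) := by
  linear_combination (-(s ^ 4 + s ^ 2 * (1 - 4 * r ^ (2 * k + 1)) +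
    (1 - 4 * r ^ (2 * k + 1)) ^ 2)) * hs

/-- The difference of the ramification function at two `v`-integral points is controlled by the
coordinate differences: `v(N(r,s) − N(a,σ)) ≤ max(v(r − a), v(s − σ))`.
[cite: MochizukiGenEll2010, Thm 2.1 proof p.13] -/
theorem valuation_N_sub_N_le {a σ : K} (hr : v r ≤ 1) (hsv : v s ≤ 1) (ha : v a ≤ 1)
    (hσ : v σ ≤ 1) :
    v ((-s ^ 3 + ((k : K) + 1) * r ^ (k + 2) - 2 * r ^ (3 * k + 3)) -
        (-σ ^ 3 + ((k : K) + 1) * a ^ (k + 2) - 2 * a ^ (3 * k + 3))) ≤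
      max (v (r - a)) (v (s - σ)) := by
  have hrew : (-s ^ 3 + ((k : K) + 1) * r ^ (k + 2) - 2 * r ^ (3 * k + 3)) -
      (-σ ^ 3 + ((k : K) + 1) * a ^ (k + 2) - 2 * a ^ (3 * k + 3)) =
      -(s ^ 3 - σ ^ 3) + (((k : K) + 1) * (r ^ (k + 2) - a ^ (k + 2)) +
        -(2 * (r ^ (3 * k + 3) - a ^ (3 * k + 3)))) := by ring
  rw [hrew]
  have h2 : v (2 : K) ≤ 1 := by exact_mod_cast valuation_natCast_le_one v 2
  have hk : v ((k : K) + 1) ≤ 1 := by exact_mod_cast valuation_natCast_le_one v (k + 1)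
  refine v.map_add_le ?_ (v.map_add_le ?_ ?_)
  · rw [Valuation.map_neg]
    exact (valuation_pow_sub_pow_le v hsv hσ 3).trans (le_max_right _ _)
  · rw [map_mul]
    exact (mul_le_of_le_one_left' hk).trans
      ((valuation_pow_sub_pow_le v hr ha _).trans (le_max_left _ _))
  · rw [Valuation.map_neg, map_mul]
    exact (mul_le_of_le_one_left' h2).trans
      ((valuation_pow_sub_pow_le v hr ha _).trans (le_max_left _ _))

/-- The ramification function is `v`-integral at a `v`-integral point.
[cite: MochizukiGenEll2010, Thm 2.1 proof p.13] -/
theorem valuation_N_le_one (hr : v r ≤ 1) (hsv : v s ≤ 1) :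
    v (-s ^ 3 + ((k : K) + 1) * r ^ (k + 2) - 2 * r ^ (3 * k + 3)) ≤ 1 := by
  have h2 : v (2 : K) ≤ 1 := by exact_mod_cast valuation_natCast_le_one v 2
  have hk : v ((k : K) + 1) ≤ 1 := by exact_mod_cast valuation_natCast_le_one v (k + 1)
  refine v.map_sub_le (v.map_add_le ?_ ?_) ?_
  · rw [Valuation.map_neg, map_pow]; exact pow_le_one₀ zero_le hsv
  · rw [map_mul, map_pow]; exact mul_le_one' hk (pow_le_one₀ zero_le hr)
  · rw [map_mul, map_pow]; exact mul_le_one' h2 (pow_le_one₀ zero_le hr)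

end Identities

section OffChart

variable {k : ℕ} {r s : K}

/-- Near the points `Q_0, Q_1` (`v r < 1`): `s` is a unit and `N ≡ −s³`, so `v N = 1`.
[cite: MochizukiGenEll2010, Thm 2.1 proof p.13] -/
theorem valuation_N_eq_one_of_r_lt (hs : s ^ 2 = 1 - 4 * r ^ (2 * k + 1)) (hr : v r < 1) :
    v (-s ^ 3 + ((k : K) + 1) * r ^ (k + 2) - 2 * r ^ (3 * k + 3)) = 1 := by
  have h4 : v (4 : K) ≤ 1 := by exact_mod_cast valuation_natCast_le_one v 4
  have h2 : v (2 : K) ≤ 1 := by exact_mod_cast valuation_natCast_le_one v 2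
  have hk : v ((k : K) + 1) ≤ 1 := by exact_mod_cast valuation_natCast_le_one v (k + 1)
  have hre : v (4 * r ^ (2 * k + 1)) < 1 := by
    rw [map_mul, map_pow]
    exact Right.mul_lt_one_of_le_of_lt h4 (pow_lt_one₀ zero_le hr (by omega))
  have hs1 : v s = 1 := by
    have hs2 : v s ^ 2 = 1 := by rw [← map_pow, hs, v.map_one_sub_of_lt hre]
    exact eq_one_of_pow_eq_one_valueGroup two_ne_zero hs2
  have hsmall : v (((k : K) + 1) * r ^ (k + 2) - 2 * r ^ (3 * k + 3)) < 1 := by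
    refine v.map_sub_lt ?_ ?_
    · rw [map_mul, map_pow]
      exact Right.mul_lt_one_of_le_of_lt hk (pow_lt_one₀ zero_le hr (by omega))
    · rw [map_mul, map_pow]
      exact Right.mul_lt_one_of_le_of_lt h2 (pow_lt_one₀ zero_le hr (by omega))
  have hrew : -s ^ 3 + ((k : K) + 1) * r ^ (k + 2) - 2 * r ^ (3 * k + 3) =
      -s ^ 3 + (((k : K) + 1) * r ^ (k + 2) - 2 * r ^ (3 * k + 3)) := by ring
  rw [hrew, v.map_add_eq_of_lt_left (by rwa [Valuation.map_neg, map_pow, hs1, one_pow]), Valuation.map_neg, map_pow,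
    hs1, one_pow]

/-- Near the Weierstrass points `W_j` (`v s < 1`) at a prime not dividing `2e`: `r` is a unit,
`2r^e ≡ 1/2`, `N ≡ r^{k+2}·e/2`, so `v N = 1`. [cite: MochizukiGenEll2010, Thm 2.1 proof p.13] -/
theorem valuation_N_eq_one_of_s_lt (hs : s ^ 2 = 1 - 4 * r ^ (2 * k + 1)) (h2 : v (2 : K) = 1)
    (he : v ((2 * k + 1 : ℕ) : K) = 1) (hsv : v s < 1) :
    v (-s ^ 3 + ((k : K) + 1) * r ^ (k + 2) - 2 * r ^ (3 * k + 3)) = 1 := by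
  have h20 : (2 : K) ≠ 0 := by
    intro h; rw [h, map_zero] at h2; exact zero_ne_one h2
  -- `4 r^e = 1 − s²` is a unit, hence so is `r`
  have h4re : v (4 * r ^ (2 * k + 1)) = 1 := by
    have : 4 * r ^ (2 * k + 1) = 1 - s ^ 2 := by rw [hs]; ring
    rw [this, v.map_one_sub_of_lt (by rw [map_pow]; exact pow_lt_one₀ zero_le hsv two_ne_zero)]
  have hr1 : v r = 1 := by
    have h4 : v (4 : K) = 1 := by
      rw [show (4 : K) = 2 * 2 by norm_num, map_mul, h2, one_mul]
    rw [map_mul, h4, one_mul, map_pow] at h4re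
    exact eq_one_of_pow_eq_one_valueGroup (by omega) h4re
  -- `N + s³ = r^{k+2}·((k+1) − 2r^e)` and `(k+1) − 2r^e = (e + s²)/2`
  have hrew : -s ^ 3 + ((k : K) + 1) * r ^ (k + 2) - 2 * r ^ (3 * k + 3) =
      r ^ (k + 2) * ((((2 * k + 1 : ℕ) : K) + s ^ 2) / 2) + -s ^ 3 := by
    rw [hs]; push_cast; field_simp; ring
  have hunit : v (r ^ (k + 2) * ((((2 * k + 1 : ℕ) : K) + s ^ 2) / 2)) = 1 := by
    rw [map_mul, map_pow, hr1, one_pow, one_mul, map_div₀, h2, div_one,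
      v.map_add_eq_of_lt_left (by rw [he, map_pow]; exact pow_lt_one₀ zero_le hsv two_ne_zero),
      he]
  rw [hrew, v.map_add_eq_of_lt_left (by
    rw [hunit, Valuation.map_neg, map_pow]; exact pow_lt_one₀ zero_le hsv three_ne_zero), hunit]

/-- Near `Q_∞` (`v r > 1`) at a prime not dividing `2`: the term `−2r^{3k+3}` dominates and
`v N = v(r)^{3k+3} > 1`, so `ord_w N(P) < 0` gives no credit either.
[cite: MochizukiGenEll2010, Thm 2.1 proof p.13] -/
theorem one_lt_valuation_N_of_r_gt (hs : s ^ 2 = 1 - 4 * r ^ (2 * k + 1)) (h2 : v (2 : K) = 1)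
    (hr : 1 < v r) :
    1 < v (-s ^ 3 + ((k : K) + 1) * r ^ (k + 2) - 2 * r ^ (3 * k + 3)) := by
  have hk : v ((k : K) + 1) ≤ 1 := by exact_mod_cast valuation_natCast_le_one v (k + 1)
  have h4 : v (4 : K) = 1 := by
    rw [show (4 : K) = 2 * 2 by norm_num, map_mul, h2, one_mul]
  have hr0 : v r ≠ 0 := ne_of_gt (lt_trans zero_lt_one hr)
  -- `v(s)² = v(r)^e`
  have hs2 : v s ^ 2 = v r ^ (2 * k + 1) := by
    have h1lt : v (1 : K) < v (4 * r ^ (2 * k + 1)) := by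
      rw [map_one, map_mul, h4, one_mul, map_pow]
      exact one_lt_pow₀ hr (by omega)
    rw [← map_pow, hs, v.map_sub_eq_of_lt_right h1lt, map_mul, h4, one_mul, map_pow]
  -- the dominant term
  have hdom : v (2 * r ^ (3 * k + 3)) = v r ^ (3 * k + 3) := by
    rw [map_mul, h2, one_mul, map_pow]
  have hlt1 : v (-s ^ 3) < v (2 * r ^ (3 * k + 3)) := by
    rw [Valuation.map_neg, map_pow, hdom]
    -- compare squares: `(v s ^ 3)^2 = v r ^ (6k+3) < v r ^ (6k+6) = (v r ^ (3k+3))^2`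
    have hsq : (v s ^ 3) ^ 2 < (v r ^ (3 * k + 3)) ^ 2 := by
      rw [show (v s ^ 3) ^ 2 = (v s ^ 2) ^ 3 by rw [← pow_mul, ← pow_mul], hs2, ← pow_mul,
        ← pow_mul]
      exact pow_lt_pow_right₀ hr (by omega)
    exact lt_of_pow_lt_pow_left₀ 2 zero_le hsq
  have hlt2 : v (((k : K) + 1) * r ^ (k + 2)) < v (2 * r ^ (3 * k + 3)) := by
    rw [hdom, map_mul, map_pow]
    calc v ((k : K) + 1) * v r ^ (k + 2) ≤ v r ^ (k + 2) := mul_le_of_le_one_left' hk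
      _ < v r ^ (3 * k + 3) := pow_lt_pow_right₀ hr (by omega)
  have hrew : -s ^ 3 + ((k : K) + 1) * r ^ (k + 2) - 2 * r ^ (3 * k + 3) =
      (-s ^ 3 + ((k : K) + 1) * r ^ (k + 2)) - 2 * r ^ (3 * k + 3) := by ring
  rw [hrew, v.map_sub_eq_of_lt_right (v.map_add_lt hlt1 hlt2), hdom]
  exact one_lt_pow₀ hr (by omega)

end OffChart

section Locus

variable {k : ℕ} {r s : K}

/-- THE LOCUS LEMMA (ramification-locus control at a good prime). In the chart `v r ≤ 1`,
`v s ≤ 1` of `D_e : s² = 1 − 4r^e`, at a prime with `v 2 = 1`, suppose `Ψ` is split: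
`Ψ(r) = c·∏_{a∈R}(r − a)` with `v c = 1` (e.g. `c = −4`, `R` = the roots of `Ψ` in `K`, from
`Polynomial.eq_prod_roots_of_splits_id` and `eval_psi`), and that `K` contains square roots
`σ_a² = 1 − 4a^e` for `a ∈ R`. If the ramification function is small at `(r,s)`, `v N(r,s) < 1`,
then `(r,s)` REDUCES TO A POINT `(a,σ)` of `Z(Ψ) ×_{r} D_e = R_t ∪ ιR_t` at which `N` is also small:
`v(r − a) < 1`, `v(s − σ) < 1`, `v N(a,σ) < 1`. (At a good prime the finitely many nonzero values
`N(a,σ)`, `(a,σ) ∈ ιR_t ∖ R_t`, are units, so then `N(a,σ) = 0`: `(a,σ) ∈ R_t` and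
`t(a,σ) ∈ A = t(R_t)`.) [cite: MochizukiGenEll2010, Thm 2.1 proof p.13] -/
theorem exists_root_near_of_valuation_N_lt (hs : s ^ 2 = 1 - 4 * r ^ (2 * k + 1))
    (hr : v r ≤ 1) (hsv : v s ≤ 1) {c : K} (hc : v c = 1) (R : Multiset K)
    (hΨ : (1 - 4 * r ^ (2 * k + 1)) ^ 3 - (((k : K) + 1) * r ^ (k + 2) - 2 * r ^ (3 * k + 3)) ^ 2 =
      c * (R.map fun a => r - a).prod)
    (hσ : ∀ a ∈ R, ∃ σ : K, σ ^ 2 = 1 - 4 * a ^ (2 * k + 1))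
    (hN : v (-s ^ 3 + ((k : K) + 1) * r ^ (k + 2) - 2 * r ^ (3 * k + 3)) < 1) :
    ∃ a ∈ R, ∃ σ : K, σ ^ 2 = 1 - 4 * a ^ (2 * k + 1) ∧ v (r - a) < 1 ∧ v (s - σ) < 1 ∧
      v (-σ ^ 3 + ((k : K) + 1) * a ^ (k + 2) - 2 * a ^ (3 * k + 3)) < 1 := by
  -- Step 1: `v Ψ(r) = v N · v Ñ < 1 = v c`, so some root is close to `r`.
  have hΨlt : v (c * (R.map fun a => r - a).prod) < v c := by
    rw [← hΨ, psi_identity hs, Valuation.map_neg, map_mul, hc]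
    have hÑ : v (-(-s) ^ 3 + ((k : K) + 1) * r ^ (k + 2) - 2 * r ^ (3 * k + 3)) ≤ 1 :=
      valuation_N_le_one v (k := k) hr (s := -s) (by rwa [Valuation.map_neg])
    exact mul_lt_one_of_lt_of_le hN hÑ
  obtain ⟨a, haR, ha⟩ := exists_valuation_sub_lt_one v c r R hΨlt
  have ha1 : v a ≤ 1 := by
    have : a = r - (r - a) := by ring
    rw [this]
    exact v.map_sub_le hr ha.le
  -- Step 2: a square root `σ` of `1 − 4a^e` with `v(s − σ) < 1` (possibly after a sign change).
  obtain ⟨σ₀, hσ₀⟩ := hσ a haR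
  have hσ₀1 : v σ₀ ≤ 1 := by
    have h4 : v (4 : K) ≤ 1 := by exact_mod_cast valuation_natCast_le_one v 4
    have hsq : v σ₀ ^ 2 ≤ 1 := by
      rw [← map_pow, hσ₀]
      refine v.map_sub_le (le_of_eq v.map_one) ?_
      rw [map_mul, map_pow]
      exact mul_le_one' h4 (pow_le_one₀ zero_le ha1)
    by_contra hgt
    exact absurd hsq (not_le.mpr (one_lt_pow₀ (not_le.mp hgt) two_ne_zero))
  have hprod : v ((s - σ₀) * (s + σ₀)) < 1 := by
    have hfac : (s - σ₀) * (s + σ₀) = -(4 * (r ^ (2 * k + 1) - a ^ (2 * k + 1))) := by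
      linear_combination hs - hσ₀
    have h4 : v (4 : K) ≤ 1 := by exact_mod_cast valuation_natCast_le_one v 4
    rw [hfac, Valuation.map_neg, map_mul]
    exact Right.mul_lt_one_of_le_of_lt h4 ((valuation_pow_sub_pow_le v hr ha1 _).trans_lt ha)
  obtain ⟨σ, hσsq, hσ1, hsσ⟩ : ∃ σ : K, σ ^ 2 = 1 - 4 * a ^ (2 * k + 1) ∧ v σ ≤ 1 ∧ v (s - σ) < 1 := by
    rcases valuation_lt_one_or_of_mul_lt_one v hprod with h | h
    · exact ⟨σ₀, hσ₀, hσ₀1, h⟩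
    · exact ⟨-σ₀, by rw [neg_sq, hσ₀], by rwa [Valuation.map_neg], by rwa [sub_neg_eq_add]⟩
  -- Step 3: `N` is Lipschitz, so `N(a,σ)` is small too.
  refine ⟨a, haR, σ, hσsq, ha, hsσ, ?_⟩
  have hdiff := valuation_N_sub_N_le v (k := k) hr hsv ha1 hσ1
  have hkey : -σ ^ 3 + ((k : K) + 1) * a ^ (k + 2) - 2 * a ^ (3 * k + 3) =
      (-s ^ 3 + ((k : K) + 1) * r ^ (k + 2) - 2 * r ^ (3 * k + 3)) -
        ((-s ^ 3 + ((k : K) + 1) * r ^ (k + 2) - 2 * r ^ (3 * k + 3)) -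
          (-σ ^ 3 + ((k : K) + 1) * a ^ (k + 2) - 2 * a ^ (3 * k + 3))) := by ring
  rw [hkey]
  exact v.map_sub_lt hN (hdiff.trans_lt (max_lt ha hsσ))

/-- THE `t`-LIPSCHITZ STEP: in the unit chart (`v r = v s = 1`), if `(r,s)` reduces to `(a,σ)`
(`v(r − a) < 1`, `v(s − σ) < 1`) then `t(r,s) = (s + r^{k+2})/(rs)` reduces to `t(a,σ)`:
`v(t(r,s) − t(a,σ)) < 1`. With the locus lemma: at a good prime, `ord_w N(P) > 0` forces `t(P)` to
MEET the critical value `t(a,σ) ∈ A ⊆ B`. [cite: MochizukiGenEll2010, Thm 2.1 proof p.13] -/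
theorem valuation_t_sub_t_lt_one {a σ : K} (hr : v r = 1) (hsv : v s = 1) (ha : v (r - a) < 1)
    (hσ : v (s - σ) < 1) :
    v ((s + r ^ (k + 2)) / (r * s) - (σ + a ^ (k + 2)) / (a * σ)) < 1 := by
  have ha1 : v a = 1 := by
    have : a = r - (r - a) := by ring
    rw [this, v.map_sub_eq_of_lt_left (by rwa [hr]), hr]
  have hσ1 : v σ = 1 := by
    have : σ = s - (s - σ) := by ring
    rw [this, v.map_sub_eq_of_lt_left (by rwa [hsv]), hsv]
  have hr0 : r ≠ 0 := fun h => by rw [h, map_zero] at hr; exact zero_ne_one hr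
  have hs0 : s ≠ 0 := fun h => by rw [h, map_zero] at hsv; exact zero_ne_one hsv
  have ha0 : a ≠ 0 := fun h => by rw [h, map_zero] at ha1; exact zero_ne_one ha1
  have hσ0 : σ ≠ 0 := fun h => by rw [h, map_zero] at hσ1; exact zero_ne_one hσ1
  have hrew : (s + r ^ (k + 2)) / (r * s) - (σ + a ^ (k + 2)) / (a * σ) =
      (s * σ * (a - r) + a * r * σ * (r ^ (k + 1) - a ^ (k + 1)) +
        a * r * a ^ (k + 1) * (σ - s)) / (r * s * a * σ) := by
    field_simp
    ring
  rw [hrew, map_div₀, map_mul, map_mul, map_mul, hr, hsv, ha1, hσ1, one_mul, one_mul, one_mul,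
    div_one]
  have har : v (a - r) < 1 := by rwa [← neg_sub, Valuation.map_neg]
  have hσs : v (σ - s) < 1 := by rwa [← neg_sub, Valuation.map_neg]
  refine v.map_add_lt (v.map_add_lt ?_ ?_) ?_
  · rw [map_mul, map_mul, hsv, hσ1, one_mul, one_mul]; exact har
  · rw [map_mul, map_mul, map_mul, ha1, hr, hσ1, one_mul, one_mul, one_mul]
    exact (valuation_pow_sub_pow_le v hr.le ha1.le _).trans_lt ha
  · rw [map_mul, map_mul, map_mul, map_pow, ha1, hr, one_pow, one_mul, one_mul, one_mul]
    exact hσs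

/-- THE COMPOSED FORM (output shape requested by the W5 holder abc-iut-w5-d045, 23:54:30Z): let
`(r,s)` be a `v`-integral point of `D_e` (`v r ≤ 1`, `v s ≤ 1`) at a GOOD prime: `v 2 = 1`,
`v e = 1`, `Ψ(r) = c·∏_{a∈R}(r − a)` with `v c = 1` and square roots `σ_a² = 1 − 4a^e` in `K`
(a fixed splitting field, independent of the point), and every NONZERO value `N(a,σ)` at a point
over a root of `Ψ` is a `v`-unit (finitely many fixed algebraic numbers: true at almost all primes);
and let `B` contain the critical values `t(a,σ)`, `(a,σ) ∈ R_t = Z(N)`. Then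
`v N(r,s) < 1 ⇒ ∃ b ∈ B, v(t(r,s) − b) < 1`: a prime dividing the ramification function at `P` is a
prime at which `t(P)` meets `B`. (Off the integral chart see `one_lt_valuation_N_of_r_gt`.)
[cite: MochizukiGenEll2010, Thm 2.1 proof p.13] -/
theorem exists_valuation_t_sub_lt_one_of_valuation_N_lt (hs : s ^ 2 = 1 - 4 * r ^ (2 * k + 1))
    (h2 : v (2 : K) = 1) (he : v ((2 * k + 1 : ℕ) : K) = 1) (hr : v r ≤ 1) (hsv : v s ≤ 1)
    {c : K} (hc : v c = 1) (R : Multiset K)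
    (hΨ : (1 - 4 * r ^ (2 * k + 1)) ^ 3 - (((k : K) + 1) * r ^ (k + 2) - 2 * r ^ (3 * k + 3)) ^ 2 =
      c * (R.map fun a => r - a).prod)
    (hσ : ∀ a ∈ R, ∃ σ : K, σ ^ 2 = 1 - 4 * a ^ (2 * k + 1))
    (hgood : ∀ a ∈ R, ∀ σ : K, σ ^ 2 = 1 - 4 * a ^ (2 * k + 1) →
      -σ ^ 3 + ((k : K) + 1) * a ^ (k + 2) - 2 * a ^ (3 * k + 3) ≠ 0 →
      v (-σ ^ 3 + ((k : K) + 1) * a ^ (k + 2) - 2 * a ^ (3 * k + 3)) = 1)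
    (B : Set K)
    (hcrit : ∀ a ∈ R, ∀ σ : K, σ ^ 2 = 1 - 4 * a ^ (2 * k + 1) →
      -σ ^ 3 + ((k : K) + 1) * a ^ (k + 2) - 2 * a ^ (3 * k + 3) = 0 →
      (σ + a ^ (k + 2)) / (a * σ) ∈ B)
    (hN : v (-s ^ 3 + ((k : K) + 1) * r ^ (k + 2) - 2 * r ^ (3 * k + 3)) < 1) :
    ∃ b ∈ B, v ((s + r ^ (k + 2)) / (r * s) - b) < 1 := by
  -- in fact `(r,s)` lies in the unit chart, since off it `N` is a unit
  have hr1 : v r = 1 := by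
    by_contra hne
    exact absurd (valuation_N_eq_one_of_r_lt v hs (lt_of_le_of_ne hr hne)) (ne_of_lt hN)
  have hs1 : v s = 1 := by
    by_contra hne
    exact absurd (valuation_N_eq_one_of_s_lt v hs h2 he (lt_of_le_of_ne hsv hne)) (ne_of_lt hN)
  obtain ⟨a, haR, σ, hσsq, ha, hsσ, hNa⟩ :=
    exists_root_near_of_valuation_N_lt v hs hr hsv hc R hΨ hσ hN
  have hzero : -σ ^ 3 + ((k : K) + 1) * a ^ (k + 2) - 2 * a ^ (3 * k + 3) = 0 := by
    by_contra hne
    exact absurd (hgood a haR σ hσsq hne) (ne_of_lt hNa)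
  exact ⟨_, hcrit a haR σ hσsq hzero, valuation_t_sub_t_lt_one v hr1 hs1 ha hsσ⟩

end Locus

end Literature.NumberTheory.DiophantineGeometry.GenEll.RamLocus
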